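/-
Copyright: internal research formalization. Source text: J. Nie and M. Schweighofer, "On the
complexity of Putinar's Positivstellensatz", J. Complexity 23 (2007) 135–150 [NieSchweighofer2007]
(held: arXiv:0812.2657), §1 pp. 3–4: quadratic module `M(ḡ)` (1), preordering `T(ḡ)` (2), basic
closed semialgebraic set `S(ḡ)`, Theorem 1 (Schmüdgen [Schmudgen1991]), Definition 2 (archimedean),
Theorem 4 (Putinar [Putinar1993]), truncations `M(ḡ,k)` (p. 4).
-/
import Mathlib
import HarnessLib

/-!
# Quadratic modules, preorderings and Putinar's / Schmüdgen's Positivstellensatz (statements)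

Literature formalization of Nie–Schweighofer 2007, §1 (pp. 3–4), the algebraic objects behind
sum-of-squares (SOS) certificates of positivity on a basic closed semialgebraic set:

* p. 3, verbatim: *"A subset `M ⊆ ℝ[X̄]` is called a quadratic module if it contains `1` and it is
  closed under addition and under multiplication with squares, i.e., `1 ∈ M`, `M + M ⊆ M` and
  `ℝ[X̄]² M ⊆ M`.  A subset `T ⊆ ℝ[X̄]` is called a preordering if it contains all squares in
  `ℝ[X̄]` and it is closed under addition and multiplication … In other words, the preorderings
  are exactly the multiplicatively closed quadratic modules."* — `IsQuadraticModule`,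
  `IsPreordering`, `isPreordering_iff`.
* (1), p. 3: *"The quadratic module `M(ḡ)` generated by `ḡ` (i.e., the smallest quadratic module
  containing each `gᵢ`) is `M(ḡ) = Σ_{i=0}^m Σℝ[X̄]² gᵢ := {Σ_{i=0}^m σᵢ gᵢ | σᵢ ∈ ΣR[X̄]²}`"*
  (`g₀ := 1`) — `quadraticModule`, `isQuadraticModule_quadraticModule`, `mem_quadraticModule_gen`,
  `quadraticModule_subset` (smallest).
* (2), p. 3: *"the preordering `T(ḡ)` generated by `ḡ` can be written as
  `T(ḡ) = Σ_{δ ∈ {0,1}^m} Σℝ[X̄]² ḡ^δ` … i.e., `T(ḡ)` is the quadratic module generated by the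
  `2^m` products of the `gᵢ`"* — `preordering` (defined by the last clause), `mem_preordering_iff`
  (the displayed formula), `isPreordering_preordering`, `quadraticModule_subset_preordering`.
* p. 3: *"It is obvious that all polynomials lying in `T(ḡ) ⊇ M(ḡ)` are nonnegative on the set
  `S(ḡ) := {x ∈ ℝⁿ | g₁(x) ≥ 0, …, g_m(x) ≥ 0}`"* — `semialgSet`, `eval_nonneg_of_mem_preordering`,
  `eval_nonneg_of_mem_quadraticModule` (the SOUNDNESS of SOS certificates: this direction is what
  a certificate checker relies on, and it is proved here).
* Definition 2, p. 3: *"A quadratic module `M ⊆ ℝ[X̄]` is called archimedean if `N - ‖X̄‖² ∈ M`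
  for some `N ∈ ℕ`"* (`‖X̄‖² := Σ Xᵢ²`) — `IsArchimedeanModule`; the trivial implication
  (ac1) ⇒ (ac2) of Corollary 3 (then `S(ḡ)` lies in a ball, hence is compact over `ℝ`) —
  `sum_sq_le_of_archimedean`, `isCompact_semialgSet_of_archimedean`.
* Theorem 4 (Putinar 1993), p. 3: *"Suppose the quadratic module `M(ḡ)` is archimedean. Then for
  every `f ∈ ℝ[X̄]`, `f > 0` on `S(ḡ) ⟹ f ∈ M(ḡ)`."* and Theorem 1 (Schmüdgen 1991), p. 3:
  *"Suppose the basic closed semialgebraic set `S(ḡ)` is compact. Then for every polynomial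
  `f ∈ ℝ[X̄]`, `f > 0` on `S(ḡ) ⟹ f ∈ T(ḡ)`."* — recorded as NAMED FACTS (statements only, to be
  used as hypotheses): `PutinarTheorem`, `SchmudgenTheorem`.  Their proofs
  (functional analysis / real algebra) are not formalised here.
* p. 4: the degree truncations `M(ḡ,k) = {Σᵢ σᵢ gᵢ | σᵢ ∈ Σℝ[X̄]², deg(σᵢ gᵢ) ≤ k} ⊆ M(ḡ) ∩ ℝ[X̄]_{≤k}`
  (the sets a degree-`k` SOS relaxation searches) — `truncQuadraticModule`,
  `truncQuadraticModule_subset`, `truncQuadraticModule_mono`.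

Generality: the algebraic notions are stated in an arbitrary commutative semiring `A` (the paper:
`A = ℝ[X₁,…,Xₙ]`), the set `S(ḡ)`, soundness and archimedean boundedness over any linearly ordered
commutative ring `R` of coefficients, compactness and the two named theorems over `ℝ`.  "Sum of
squares" is Mathlib's `IsSumSq`.  Mathlib has `IsSumSq` and its closure properties but (as of this
file) no quadratic modules, preorderings, archimedean property or any Positivstellensatz; the tree
has Pólya's and Handelman's theorems (`PolyaPositivstellensatz.lean`, `HandelmanPolytope.lean`) but
not Putinar's or Schmüdgen's.
-/

namespace Literature.Algebra.Polynomial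

namespace PutinarPositivstellensatz

open MvPolynomial Finset

/-! ## Quadratic modules and preorderings in a commutative semiring -/

section Algebra

variable {A : Type*} [CommSemiring A]

/-- A subset `M` of a commutative (semi)ring is a **quadratic module** if it contains `1` and is
closed under addition and under multiplication with squares: `1 ∈ M`, `M + M ⊆ M`, `A² M ⊆ M`
(Nie–Schweighofer 2007, §1 p. 3). [cite: NieSchweighofer2007, §1 (p. 3)] -/
def IsQuadraticModule (M : Set A) : Prop :=
  1 ∈ M ∧ (∀ p ∈ M, ∀ q ∈ M, p + q ∈ M) ∧ ∀ (a : A), ∀ q ∈ M, a * a * q ∈ M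

/-- A subset `T` is a **preordering** if it contains all squares and is closed under addition and
multiplication: `A² ⊆ T`, `T + T ⊆ T`, `T T ⊆ T` (Nie–Schweighofer 2007, §1 p. 3).
[cite: NieSchweighofer2007, §1 (p. 3)] -/
def IsPreordering (T : Set A) : Prop :=
  (∀ a : A, a * a ∈ T) ∧ (∀ p ∈ T, ∀ q ∈ T, p + q ∈ T) ∧ ∀ p ∈ T, ∀ q ∈ T, p * q ∈ T

/-- *"In other words, the preorderings are exactly the multiplicatively closed quadratic modules"*
(Nie–Schweighofer 2007, §1 p. 3). [cite: NieSchweighofer2007, §1 (p. 3)] -/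
theorem isPreordering_iff (T : Set A) :
    IsPreordering T ↔ IsQuadraticModule T ∧ ∀ p ∈ T, ∀ q ∈ T, p * q ∈ T := by
  constructor
  · rintro ⟨hsq, hadd, hmul⟩
    refine ⟨⟨by simpa using hsq 1, hadd, fun a q hq => hmul _ (hsq a) _ hq⟩, hmul⟩
  · rintro ⟨⟨h1, hadd, hsq⟩, hmul⟩
    exact ⟨fun a => by simpa using hsq a 1 h1, hadd, hmul⟩

/-- In a quadratic module, a sum of squares times an element is again an element (iterate the
axiom `a² M ⊆ M` along Mathlib's inductive `IsSumSq`). [cite: NieSchweighofer2007, §1 (p. 3)] -/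
theorem IsQuadraticModule.isSumSq_mul_mem {M : Set A} (hM : IsQuadraticModule M) {s q : A}
    (hs : IsSumSq s) (hq : q ∈ M) : s * q ∈ M := by
  induction hs with
  | zero => simpa using hM.2.2 0 q hq
  | sq_add a hS ih =>
    rw [add_mul]
    exact hM.2.1 _ (hM.2.2 a q hq) _ ih

/-- A quadratic module contains every sum of squares (take `q = 1`).
[cite: NieSchweighofer2007, §1 (p. 3)] -/
theorem IsQuadraticModule.mem_of_isSumSq {M : Set A} (hM : IsQuadraticModule M) {s : A}
    (hs : IsSumSq s) : s ∈ M := by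
  simpa using hM.isSumSq_mul_mem hs hM.1

/-- A quadratic module is closed under finite sums. [cite: NieSchweighofer2007, §1 (p. 3)] -/
theorem IsQuadraticModule.sum_mem {M : Set A} (hM : IsQuadraticModule M) {ι : Type*}
    (I : Finset ι) {f : ι → A} (hf : ∀ i ∈ I, f i ∈ M) : ∑ i ∈ I, f i ∈ M := by
  classical
  induction I using Finset.induction_on with
  | empty => simpa using hM.mem_of_isSumSq IsSumSq.zero
  | insert i I hi ih =>
    rw [sum_insert hi]
    exact hM.2.1 _ (hf i (mem_insert_self i I)) _ (ih fun j hj => hf j (mem_insert_of_mem hj))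

variable {ι : Type*} [Fintype ι]

/-- **The quadratic module `M(ḡ)` generated by `ḡ = (g₁,…,g_m)`** (Nie–Schweighofer 2007, (1),
p. 3): `M(ḡ) = {σ₀ + Σᵢ σᵢ gᵢ | σ₀, σᵢ sums of squares}` (the paper writes `Σ_{i=0}^m σᵢ gᵢ` with
`g₀ := 1`). [cite: NieSchweighofer2007, (1) (p. 3)] -/
def quadraticModule (g : ι → A) : Set A :=
  {f | ∃ (s₀ : A) (s : ι → A), IsSumSq s₀ ∧ (∀ i, IsSumSq (s i)) ∧ f = s₀ + ∑ i, s i * g i}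

/-- `M(ḡ)` is a quadratic module (Nie–Schweighofer 2007, (1), p. 3).
[cite: NieSchweighofer2007, (1) (p. 3)] -/
theorem isQuadraticModule_quadraticModule (g : ι → A) : IsQuadraticModule (quadraticModule g) := by
  refine ⟨⟨1, 0, IsSumSq.one, fun _ => IsSumSq.zero, by simp⟩, ?_, ?_⟩
  · rintro p ⟨s₀, s, hs₀, hs, rfl⟩ q ⟨t₀, t, ht₀, ht, rfl⟩
    refine ⟨s₀ + t₀, s + t, hs₀.add ht₀, fun i => (hs i).add (ht i), ?_⟩
    simp only [Pi.add_apply, add_mul, sum_add_distrib]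
    ring
  · rintro a q ⟨t₀, t, ht₀, ht, rfl⟩
    refine ⟨a * a * t₀, fun i => a * a * t i, (IsSumSq.mul_self a).mul ht₀,
      fun i => (IsSumSq.mul_self a).mul (ht i), ?_⟩
    rw [mul_add, mul_sum]
    simp only [mul_assoc]

/-- Each generator `gᵢ` lies in `M(ḡ)` (Nie–Schweighofer 2007, (1), p. 3).
[cite: NieSchweighofer2007, (1) (p. 3)] -/
theorem mem_quadraticModule_gen (g : ι → A) (i : ι) : g i ∈ quadraticModule g := by
  classical
  refine ⟨0, fun j => if j = i then 1 else 0, IsSumSq.zero, fun j => ?_, ?_⟩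
  · by_cases h : j = i
    · simp only [h, if_true]; exact IsSumSq.one
    · simp only [h, if_false]; exact IsSumSq.zero
  · simp

/-- **`M(ḡ)` is the smallest quadratic module containing each `gᵢ`** (Nie–Schweighofer 2007, (1),
p. 3: *"i.e., the smallest quadratic module containing each `gᵢ`"*).
[cite: NieSchweighofer2007, (1) (p. 3)] -/
theorem quadraticModule_subset {M : Set A} (hM : IsQuadraticModule M) {g : ι → A}
    (hg : ∀ i, g i ∈ M) : quadraticModule g ⊆ M := by
  rintro f ⟨s₀, s, hs₀, hs, rfl⟩
  exact hM.2.1 _ (hM.mem_of_isSumSq hs₀) _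
    (hM.sum_mem univ fun i _ => hM.isSumSq_mul_mem (hs i) (hg i))

/-- **The preordering `T(ḡ)` generated by `ḡ`**, defined as in the last clause of
Nie–Schweighofer 2007, (2), p. 3: *"`T(ḡ)` is the quadratic module generated by the `2^m`
products of the `gᵢ`"* — the products `ḡ^δ = Π_{i ∈ δ} gᵢ` over the subsets `δ ⊆ {1,…,m}`
(`δ ∈ {0,1}^m`). [cite: NieSchweighofer2007, (2) (p. 3)] -/
def preordering (g : ι → A) : Set A :=
  quadraticModule fun δ : Finset ι => ∏ i ∈ δ, g i

/-- The displayed formula (2) of Nie–Schweighofer 2007, p. 3: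
`T(ḡ) = {Σ_{δ ∈ {0,1}^m} σ_δ ḡ^δ | σ_δ ∈ Σℝ[X̄]²}` (the constant sum of squares `σ₀` of the
quadratic-module description is absorbed into the coefficient of the empty product `ḡ^∅ = 1`).
[cite: NieSchweighofer2007, (2) (p. 3)] -/
theorem mem_preordering_iff (g : ι → A) (f : A) :
    f ∈ preordering g ↔
      ∃ s : Finset ι → A, (∀ δ, IsSumSq (s δ)) ∧ f = ∑ δ, s δ * ∏ i ∈ δ, g i := by
  classical
  constructor
  · rintro ⟨s₀, s, hs₀, hs, rfl⟩
    refine ⟨fun δ => s δ + if δ = ∅ then s₀ else 0, fun δ => ?_, ?_⟩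
    · by_cases h : δ = ∅
      · simp only [h, if_true]; exact (hs ∅).add hs₀
      · simp only [h, if_false, add_zero]; exact hs δ
    · simp only [add_mul, sum_add_distrib, ite_mul, zero_mul, sum_ite_eq', mem_univ, if_true,
        prod_empty, mul_one]
      ring
  · rintro ⟨s, hs, rfl⟩
    exact ⟨0, s, IsSumSq.zero, hs, by simp⟩

/-- `T(ḡ)` is a quadratic module containing each product `ḡ^δ`; in particular it contains
`M(ḡ)`: *"`T(ḡ) ⊇ M(ḡ)`"* (Nie–Schweighofer 2007, p. 3). [cite: NieSchweighofer2007, (2) (p. 3)] -/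
theorem quadraticModule_subset_preordering (g : ι → A) : quadraticModule g ⊆ preordering g := by
  refine quadraticModule_subset (isQuadraticModule_quadraticModule _) fun i => ?_
  have h := mem_quadraticModule_gen (fun δ : Finset ι => ∏ j ∈ δ, g j) {i}
  simpa using h

/-- The product of two of the `2^m` generators `ḡ^δ ḡ^ε = (ḡ^{δ∩ε})² ḡ^{δ ∪ ε ∖ δ ∩ ε}` lies in
`T(ḡ)` (a square times a generator). [cite: NieSchweighofer2007, (2) (p. 3)] -/
theorem prod_mul_prod_mem_preordering [DecidableEq ι] (g : ι → A) (δ ε : Finset ι) :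
    (∏ i ∈ δ, g i) * ∏ i ∈ ε, g i ∈ preordering g := by
  have hQ := isQuadraticModule_quadraticModule (fun δ : Finset ι => ∏ j ∈ δ, g j)
  have key : (∏ i ∈ δ, g i) * ∏ i ∈ ε, g i =
      (∏ i ∈ δ ∩ ε, g i) * (∏ i ∈ δ ∩ ε, g i) * ∏ i ∈ (δ ∪ ε) \ (δ ∩ ε), g i := by
    rw [← prod_union_inter, ← prod_sdiff (inter_subset_union : δ ∩ ε ⊆ δ ∪ ε)]
    ring
  rw [key]
  exact hQ.2.2 _ _ (mem_quadraticModule_gen (fun δ : Finset ι => ∏ j ∈ δ, g j) _)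

/-- **`T(ḡ)` is a preordering** (closed under multiplication as well): Nie–Schweighofer 2007,
(2), p. 3, *"the preordering `T(ḡ)` generated by `ḡ`"*. [cite: NieSchweighofer2007, (2) (p. 3)] -/
theorem isPreordering_preordering (g : ι → A) : IsPreordering (preordering g) := by
  classical
  have hQ : IsQuadraticModule (preordering g) := isQuadraticModule_quadraticModule _
  refine (isPreordering_iff _).2 ⟨hQ, fun p hp q hq => ?_⟩
  obtain ⟨s, hs, rfl⟩ := (mem_preordering_iff g p).1 hp
  obtain ⟨t, ht, rfl⟩ := (mem_preordering_iff g q).1 hq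
  rw [sum_mul_sum]
  refine hQ.sum_mem _ fun δ _ => hQ.sum_mem _ fun ε _ => ?_
  have h := hQ.isSumSq_mul_mem ((hs δ).mul (ht ε)) (prod_mul_prod_mem_preordering g δ ε)
  convert h using 1
  ring

/-- `T(ḡ)` is the smallest preordering containing each `gᵢ`. [cite: NieSchweighofer2007, (2) (p. 3)] -/
theorem preordering_subset {T : Set A} (hT : IsPreordering T) {g : ι → A} (hg : ∀ i, g i ∈ T) :
    preordering g ⊆ T := by
  classical
  have hQ := ((isPreordering_iff T).1 hT).1
  refine quadraticModule_subset hQ fun δ => ?_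
  induction δ using Finset.induction_on with
  | empty => simpa using hQ.1
  | insert i δ hi ih =>
    rw [prod_insert hi]
    exact hT.2.2 _ (hg i) _ ih

/-- **The degree-`k` truncation `M(ḡ,k)`** of the quadratic module (Nie–Schweighofer 2007, p. 4):
`M(ḡ,k) = {Σᵢ σᵢ gᵢ | σᵢ ∈ Σℝ[X̄]², deg(σᵢ gᵢ) ≤ k}` — the set a degree-`k` SOS relaxation ranges
over; here for `A = R[X_σ]` with `deg` = total degree. [cite: NieSchweighofer2007, §1 (p. 4)] -/
def truncQuadraticModule {R σ : Type*} [CommSemiring R] (g : ι → MvPolynomial σ R) (k : ℕ) :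
    Set (MvPolynomial σ R) :=
  {f | ∃ (s₀ : MvPolynomial σ R) (s : ι → MvPolynomial σ R), IsSumSq s₀ ∧ (∀ i, IsSumSq (s i)) ∧
    s₀.totalDegree ≤ k ∧ (∀ i, (s i * g i).totalDegree ≤ k) ∧ f = s₀ + ∑ i, s i * g i}

/-- `M(ḡ,k) ⊆ M(ḡ)` (Nie–Schweighofer 2007, p. 4: `M(ḡ,k) ⊆ M(ḡ) ∩ ℝ[X̄]_{≤k}`, first half).
[cite: NieSchweighofer2007, §1 (p. 4)] -/
theorem truncQuadraticModule_subset {R σ : Type*} [CommSemiring R] (g : ι → MvPolynomial σ R)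
    (k : ℕ) : truncQuadraticModule g k ⊆ quadraticModule g := by
  rintro f ⟨s₀, s, hs₀, hs, -, -, rfl⟩
  exact ⟨s₀, s, hs₀, hs, rfl⟩

/-- Elements of `M(ḡ,k)` have total degree `≤ k` (Nie–Schweighofer 2007, p. 4:
`M(ḡ,k) ⊆ M(ḡ) ∩ ℝ[X̄]_{≤k}`, second half). [cite: NieSchweighofer2007, §1 (p. 4)] -/
theorem totalDegree_le_of_mem_truncQuadraticModule {R σ : Type*} [CommSemiring R]
    (g : ι → MvPolynomial σ R) (k : ℕ) {f : MvPolynomial σ R} (hf : f ∈ truncQuadraticModule g k) :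
    f.totalDegree ≤ k := by
  obtain ⟨s₀, s, -, -, h₀, h, rfl⟩ := hf
  refine (totalDegree_add _ _).trans (max_le h₀ ?_)
  exact (totalDegree_finsetSum _ _).trans (Finset.sup_le fun i _ => h i)

/-- The truncations increase with `k`. [cite: NieSchweighofer2007, §1 (p. 4)] -/
theorem truncQuadraticModule_mono {R σ : Type*} [CommSemiring R] (g : ι → MvPolynomial σ R)
    {k l : ℕ} (hkl : k ≤ l) : truncQuadraticModule g k ⊆ truncQuadraticModule g l := by
  rintro f ⟨s₀, s, hs₀, hs, h₀, h, rfl⟩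
  exact ⟨s₀, s, hs₀, hs, h₀.trans hkl, fun i => (h i).trans hkl, rfl⟩

end Algebra

/-! ## The set `S(ḡ)`, soundness of certificates, the archimedean property -/

section Ordered

variable {R : Type*} [CommRing R] [LinearOrder R] [IsStrictOrderedRing R] {σ ι : Type*}

/-- **The basic closed semialgebraic set** `S(ḡ) := {x ∈ Rⁿ | g₁(x) ≥ 0, …, g_m(x) ≥ 0}`
(Nie–Schweighofer 2007, §1 p. 3). [cite: NieSchweighofer2007, §1 (p. 3)] -/
def semialgSet (g : ι → MvPolynomial σ R) : Set (σ → R) :=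
  {x | ∀ i, 0 ≤ eval x (g i)}

/-- A sum of squares of polynomials is nonnegative at every point (the reason SOS certificates are
sound). [cite: NieSchweighofer2007, §1 (p. 3)] -/
theorem eval_nonneg_of_isSumSq {p : MvPolynomial σ R} (hp : IsSumSq p) (x : σ → R) :
    0 ≤ eval x p := by
  induction hp with
  | zero => simp
  | sq_add a hS ih =>
    rw [map_add, map_mul]
    exact add_nonneg (mul_self_nonneg _) ih

variable [Fintype ι]

/-- **Soundness of preordering certificates**: *"all polynomials lying in `T(ḡ) ⊇ M(ḡ)` are
nonnegative on the set `S(ḡ)`"* (Nie–Schweighofer 2007, §1 p. 3).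
[cite: NieSchweighofer2007, §1 (p. 3)] -/
theorem eval_nonneg_of_mem_preordering {g : ι → MvPolynomial σ R} {f : MvPolynomial σ R}
    (hf : f ∈ preordering g) {x : σ → R} (hx : x ∈ semialgSet g) : 0 ≤ eval x f := by
  classical
  obtain ⟨s, hs, rfl⟩ := (mem_preordering_iff g f).1 hf
  rw [map_sum]
  refine sum_nonneg fun δ _ => ?_
  rw [map_mul, map_prod]
  exact mul_nonneg (eval_nonneg_of_isSumSq (hs δ) x) (prod_nonneg fun i _ => hx i)

/-- **Soundness of quadratic-module (Putinar-type) certificates**: every `f ∈ M(ḡ)` — i.e. every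
`f` with an SOS representation `f = σ₀ + Σ σᵢ gᵢ` — is nonnegative on `S(ḡ)` (Nie–Schweighofer
2007, §1 p. 3).  This is the direction a certificate verifier uses: exhibiting
`f - ε ∈ M(ḡ)` proves `f ≥ ε` on `S(ḡ)`. [cite: NieSchweighofer2007, §1 (p. 3)] -/
theorem eval_nonneg_of_mem_quadraticModule {g : ι → MvPolynomial σ R} {f : MvPolynomial σ R}
    (hf : f ∈ quadraticModule g) {x : σ → R} (hx : x ∈ semialgSet g) : 0 ≤ eval x f :=
  eval_nonneg_of_mem_preordering (quadraticModule_subset_preordering g hf) hx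

/-- Certificate form of soundness: an SOS representation of `f - C ε` in `M(ḡ)` certifies the
lower bound `ε ≤ f(x)` on `S(ḡ)`. [cite: NieSchweighofer2007, §1 (p. 3)] -/
theorem le_eval_of_sub_C_mem_quadraticModule {g : ι → MvPolynomial σ R} {f : MvPolynomial σ R}
    {ε : R} (hf : f - C ε ∈ quadraticModule g) {x : σ → R} (hx : x ∈ semialgSet g) :
    ε ≤ eval x f := by
  have h := eval_nonneg_of_mem_quadraticModule hf hx
  rw [map_sub, eval_C] at h
  linarith

variable [Fintype σ]

/-- **Archimedean quadratic modules** (Nie–Schweighofer 2007, Definition 2, p. 3): a quadratic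
module `M ⊆ R[X̄]` is archimedean if `N - ‖X̄‖² ∈ M` for some `N ∈ ℕ`, where `‖X̄‖² := Σᵢ Xᵢ²`.
[cite: NieSchweighofer2007, Definition 2 (p. 3)] -/
def IsArchimedeanModule (M : Set (MvPolynomial σ R)) : Prop :=
  ∃ N : ℕ, C (N : R) - ∑ j, X j ^ 2 ∈ M

/-- If `M(ḡ)` is archimedean then `S(ḡ)` lies in the ball `‖x‖² ≤ N` (the trivial implication
(ac1) ⇒ (ac2) in Nie–Schweighofer 2007, Corollary 3, p. 3, by soundness applied to
`N - ‖X̄‖² ∈ M(ḡ)`). [cite: NieSchweighofer2007, Corollary 3 (p. 3)] -/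
theorem sum_sq_le_of_archimedean {g : ι → MvPolynomial σ R}
    (h : IsArchimedeanModule (quadraticModule g)) :
    ∃ N : ℕ, ∀ x ∈ semialgSet g, ∑ j, x j ^ 2 ≤ N := by
  obtain ⟨N, hN⟩ := h
  refine ⟨N, fun x hx => ?_⟩
  have h0 := eval_nonneg_of_mem_quadraticModule hN hx
  simp only [map_sub, eval_C, map_sum, map_pow, eval_X, sub_nonneg] at h0
  exact_mod_cast h0

end Ordered

/-! ## Over `ℝ`: compactness and the two Positivstellensätze as named statements -/

section Real

variable {σ ι : Type*} [Fintype ι] [Fintype σ]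

omit [Fintype ι] [Fintype σ] in
/-- `S(ḡ)` is closed (a *basic closed* semialgebraic set, Nie–Schweighofer 2007, p. 3).
[cite: NieSchweighofer2007, §1 (p. 3)] -/
theorem isClosed_semialgSet (g : ι → MvPolynomial σ ℝ) : IsClosed (semialgSet g) := by
  have : semialgSet g = ⋂ i, {x | 0 ≤ eval x (g i)} := by
    ext x; simp [semialgSet]
  rw [this]
  exact isClosed_iInter fun i => isClosed_le continuous_const (MvPolynomial.continuous_eval (g i))

/-- If `M(ḡ)` is archimedean then `S(ḡ) ⊆ ℝⁿ` is compact (Nie–Schweighofer 2007, Corollary 3,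
(ac1) ⇒ (ac2), p. 3: closed and inside the ball `‖x‖² ≤ N`).
[cite: NieSchweighofer2007, Corollary 3 (p. 3)] -/
theorem isCompact_semialgSet_of_archimedean {g : ι → MvPolynomial σ ℝ}
    (h : IsArchimedeanModule (quadraticModule g)) : IsCompact (semialgSet g) := by
  obtain ⟨N, hN⟩ := sum_sq_le_of_archimedean h
  refine Metric.isCompact_of_isClosed_isBounded (isClosed_semialgSet g)
    ((Metric.isBounded_iff_subset_closedBall 0).2 ⟨Real.sqrt N, fun x hx => ?_⟩)
  rw [Metric.mem_closedBall, dist_zero_right, pi_norm_le_iff_of_nonneg (Real.sqrt_nonneg _)]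
  intro j
  rw [Real.norm_eq_abs]
  refine Real.abs_le_sqrt ?_
  calc x j ^ 2 ≤ ∑ k, x k ^ 2 := single_le_sum (fun k _ => sq_nonneg (x k)) (mem_univ j)
    _ ≤ N := hN x hx

/-- **Putinar's Positivstellensatz** (Putinar 1993; Nie–Schweighofer 2007, Theorem 4, p. 3),
recorded as a NAMED STATEMENT (not proved here; use as a hypothesis `(h : PutinarTheorem)`):
*"Suppose the quadratic module `M(ḡ)` is archimedean. Then for every `f ∈ ℝ[X̄]`,
`f > 0` on `S(ḡ) ⟹ f ∈ M(ḡ)`."* — for every number of variables `n` and of generators `m`.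
[cite: NieSchweighofer2007, Theorem 4 (p. 3)] [cite: Putinar1993, main theorem] -/
def PutinarTheorem : Prop :=
  ∀ (n m : ℕ) (g : Fin m → MvPolynomial (Fin n) ℝ), IsArchimedeanModule (quadraticModule g) →
    ∀ f : MvPolynomial (Fin n) ℝ, (∀ x ∈ semialgSet g, 0 < eval x f) → f ∈ quadraticModule g

/-- **Schmüdgen's Positivstellensatz** (Schmüdgen 1991; Nie–Schweighofer 2007, Theorem 1, p. 3),
recorded as a NAMED STATEMENT (not proved here): *"Suppose the basic closed semialgebraic set
`S(ḡ)` is compact. Then for every polynomial `f ∈ ℝ[X̄]`, `f > 0` on `S(ḡ) ⟹ f ∈ T(ḡ)`."*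
[cite: NieSchweighofer2007, Theorem 1 (p. 3)] [cite: Schmudgen1991, main theorem] -/
def SchmudgenTheorem : Prop :=
  ∀ (n m : ℕ) (g : Fin m → MvPolynomial (Fin n) ℝ), IsCompact (semialgSet g) →
    ∀ f : MvPolynomial (Fin n) ℝ, (∀ x ∈ semialgSet g, 0 < eval x f) → f ∈ preordering g

/-- Under Putinar's theorem, for archimedean `M(ḡ)` membership in the quadratic module
characterises strict positivity up to the boundary case: `f > 0` on `S(ḡ)` implies `f ∈ M(ḡ)`
implies `f ≥ 0` on `S(ḡ)` (Theorem 4 combined with the soundness remark of p. 3).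
[cite: NieSchweighofer2007, Theorem 4 (p. 3)] -/
theorem pos_imp_mem_imp_nonneg (hP : PutinarTheorem) {n m : ℕ}
    (g : Fin m → MvPolynomial (Fin n) ℝ) (hg : IsArchimedeanModule (quadraticModule g))
    (f : MvPolynomial (Fin n) ℝ) :
    ((∀ x ∈ semialgSet g, 0 < eval x f) → f ∈ quadraticModule g) ∧
      (f ∈ quadraticModule g → ∀ x ∈ semialgSet g, 0 ≤ eval x f) :=
  ⟨hP n m g hg f, fun hf _ hx => eval_nonneg_of_mem_quadraticModule hf hx⟩

/-- Schmüdgen's theorem implies Putinar's conclusion with `T(ḡ)` in place of `M(ḡ)` whenever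
`M(ḡ)` is archimedean (since then `S(ḡ)` is compact, Corollary 3 (ac1) ⇒ (ac2)); Putinar's theorem
is the refinement *"this theorem remains true with `T(ḡ)` replaced by its subset `M(ḡ)`"* (p. 3).
[cite: NieSchweighofer2007, §1 (p. 3)] -/
theorem mem_preordering_of_pos_of_archimedean (hS : SchmudgenTheorem) {n m : ℕ}
    (g : Fin m → MvPolynomial (Fin n) ℝ) (hg : IsArchimedeanModule (quadraticModule g))
    (f : MvPolynomial (Fin n) ℝ) (hf : ∀ x ∈ semialgSet g, 0 < eval x f) : f ∈ preordering g :=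
  hS n m g (isCompact_semialgSet_of_archimedean hg) f hf

end Real

end PutinarPositivstellensatz

end Literature.Algebra.Polynomial
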